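import Literature.Barriers.RiemannHypothesis.EpsteinZetaStark
import Literature.Barriers.RiemannHypothesis.EpsteinZetaBatemanGrosswaldEq11Proofs
import Literature.NumberTheory.DiophantineGeometry.AbcWave0GranvilleStarkEq11Proofs
import HarnessLib

/-!
# Barrier audit of `EpsteinZetaRealZeros` (D-0021): the narrowed record `EpsteinZetaRealZerosNarrow`, proved

Barrier catalogue `Literature/Barriers/RiemannHypothesis/`, companion of `EpsteinZetaRealZeros.lean`
(barrier audit 2026-08-16 of the entry `Literature.Barriers.RiemannHypothesis.EpsteinZetaRealZeros`,
"Epstein zeta functions of binary quadratic forms have real zeros in `(½, 1)`"). The narrowed record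
lives in this separate file because the facts that delimit the barrier are PROVED downstream of
`EpsteinZetaRealZeros.lean` (which they import), so they cannot be conjoined there without an import
cycle; the original entry's `scope_caveats:` / `evasions_known:` point here.

## What the audit found

1. **Formal content: confirmed — indeed proved.** The catalogued declaration
   `EpsteinZetaRealZeros = BatemanGrosswald1964_realZero ∧ Stark1967_thm1` is a theorem of the tree,
   `Literature.Barriers.RiemannHypothesis.EpsteinZetaRealZeros_holds` (`EpsteinZetaStark.lean`; axioms
   `propext`, `Classical.choice`, `Quot.sound`), as are the continuation
   (`MontgomeryVaughan2007_epsteinContinuation_holds`), Davenport–Heilbronn's zeros in `σ > 1`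
   (`DavenportHeilbronn1936b_epstein_holds`) and Bateman–Grosswald's complementary inequality (11)
   (`BatemanGrosswald1964_eq11_holds`). The printed statements were re-read: Stark, Mathematika 14
   (1967), §1 ("Bateman and Grosswald [1] have shown that `ζ(s, Q)` has a real zero between `½` and `1`
   if `k > 7.0556`") and Theorem 1.
2. **Technique class: narrower than tagged.** The entry tags `Deuring-Heilbronn`,
   `Chowla-Selberg-Kronecker-limit-expansion`, `zeta(2s)-plus-k^(1-2s)zeta(2s-1)-decomposition`,
   `class-by-class-treatment-of-Dedekind-zeta`, `theta-series-Poisson-summation` as blocked. What a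
   per-form real zero blocks is the SINGLE-FORM / CLASS-ISOLATED use of these tools. Their
   CLASS-AGGREGATE use — the same Selberg–Chowla expansion "summed over all ideal classes"
   (Granville–Stark, §3.2) — is the standard productive route on the exceptional-zero problem and is
   formalised in the tree: `ζ(s)L(s, χ_{−d}) = ½ ∑_{Q reduced} Z_Q(s)`
   (`Literature.NumberTheory.DiophantineGeometry.riemannZeta_mul_LFunction_eq_half_sum`), Granville–Stark's
   eq. (11) `h(−d)(L′/L(1, χ) + ½ log d) = (π/6)√d ∑ 1/a + O(∑ log(√d/a))`
   (`Literature.NumberTheory.DiophantineGeometry.granvilleStark_eq11`, proved) and Theorem 2, uniform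
   abc ⇒ no Siegel zeros for `χ_{−d}`
   (`Literature.NumberTheory.DiophantineGeometry.granville_stark_noSiegelZeros_of_lemma1Data`); the
   class-summed central values give Iwaniec's "`L(½, χ_D) ≥ 0` ⇒ `h ≫ D^{1/4} log D`" ((4.24)–(4.25));
   and Low (1968, Theorem 5: `L_{−d}(s) ≠ 0` for `s > 0`, `d < 593000`, `−d` fundamental, except
   possibly `d = 115147`) and Watkins (2004: odd real characters to conductor `3·10⁸`) verify the
   CLASS SUM free of real zeros in ranges where the principal Epstein zeta function of every `d ≤ −200`
   does vanish in `(½, 1)`. Deuring–Heilbronn is the entry's own listed evasion.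
3. **Scope: per form.** The real zero needs `k = √|d|/(2a) > 7.0556` (`= 4πe^{−γ}` up to rounding,
   Bateman–Grosswald Theorem 3); for `√3/2 ≤ k ≤ 7.0554` the central value is NEGATIVE
   (Bateman–Grosswald (11)), so among the `h(d)` reduced classes of one discriminant the sign-change
   mechanism is confined to the classes with small minimum `a < √|d|/14.11`. Boundary instance
   `d = −203` (reduced forms `(1, 1, 51)`, `(3, ±1, 17)`, `(7, 7, 9)`, `k ≈ 7.12, 2.37, 2.37, 1.02`):
   `Z(½) > 0` and a real zero for the principal class only (`d203_centralValue_signs`).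

## The narrowed record

`EpsteinZetaRealZerosNarrow := EpsteinZetaRealZeros ∧ BatemanGrosswald1964_eq11 ∧ ClassSum`, where
`ClassSum` is the class-sum identity `ζ(s) L(s, χ) = ½ ∑_{Q ∈ reducedForms(−d)} Z_Q(s)` (`χ` odd real
primitive mod `d > 4`, real `s > 1`) written out. All three conjuncts are theorems, so the record is
discharged: `EpsteinZetaRealZerosNarrow_holds`.

## References

* [Stark1967EpsteinZeros] H. M. Stark, *On the zeros of Epstein's zeta function*, Mathematika 14
  (1967), 47–55, §1 and Theorem 1 (read, lit `paper:galaxy-pdf-5324005613563532040`, p. 1).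
* [BatemanGrosswald1964] P. T. Bateman, E. Grosswald, *On Epstein's zeta function*, Acta Arith. 9
  (1964), 365–373, Theorem 3 (9)–(11) (as vendored in `EpsteinZetaBatemanGrosswald.lean`).
* [GranvilleStark2000] A. Granville, H. M. Stark, *ABC implies no "Siegel zeros" for L-functions of
  characters with negative discriminant*, Invent. Math. 139 (2000), 509–523: Theorems 1–3, §3.1
  Remark 1, §3.2 eq. (11) (read, lit `paper:galaxy-pdf-4469120640`, pp. 2, 7–8).
* [IwaniecConversations2006] H. Iwaniec, *Conversations on the exceptional character*, LNM 1891
  (2006), §3 (3.4), §4 (4.24)–(4.25) (read in the held Cetraro volume, pp. 87, 91).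
* [Low1968] M. E. Low, *Real zeros of the Dedekind zeta function of an imaginary quadratic field*,
  Acta Arith. 14 (1968), 117–140, Theorem 5 (held scan without text layer; statement through
  MR 38#4425, *Reviews in Number Theory 1940–72*, M20-34, read).
* [Watkins2004RealZeros] M. Watkins, *Real zeros of real odd Dirichlet L-functions*, Math. Comp. 73
  (2004), 415–423 (not held; cited through [Cohen2007NumberTheoryII], §10.5.7: "it has been checked
  for odd real characters up to conductor `3·10⁸` (see [Watk])", read).
* [Cohen2007NumberTheoryII] H. Cohen, *Number Theory II*, GTM 240, §10.5.7 (read).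
* [MontgomeryVaughan2007] §10.1 Exercise 26, §11.5 (notes to §11.3).
-/

noncomputable section

open Complex
open Literature.NumberTheory.QuadraticFields.BinaryQuadraticForm (reducedForms)

namespace Literature.Barriers.RiemannHypothesis

/-! ## The narrowed record -/

/-- **Barrier `EpsteinZetaRealZerosNarrow` (barrier audit of `EpsteinZetaRealZeros`, D-0021).** The
per-form real-zero facts (`EpsteinZetaRealZeros`: Bateman–Grosswald's real zero in `(½, 1)` for
`k = √|d|/(2a) > 7.0556` and Stark's Theorem 1), conjoined with the two facts that delimit them: the
complementary central-value inequality "`Z(½) < 0` if `√3/2 ≤ k ≤ 7.0554`" (`BatemanGrosswald1964_eq11`)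
and the class-sum identity `ζ(s) L(s, χ_{−d}) = ½ ∑_{Q reduced of disc. −d} Z_Q(s)` (`s > 1`, `χ` the
odd real primitive character mod `d > 4`), the object on which the exceptional-zero problem lives and
to which the per-form facts do not transfer.

BARRIER (structured block, D-0021):
- technique_class: functional-equation-only no-Euler-product Epstein-zeta binary-quadratic-form-zeta single-form-Chowla-Selberg-expansion single-form-zeta(2s)-plus-k^(1-2s)zeta(2s-1)-decomposition class-isolated-sign-arguments individual-ideal-class-zeta real-axis-sign-arguments-for-zeta_Q exceptional-zero Siegel-zero
- blocks: (i) the analogue of RiemannHypothesis, and the absence of real zeros in `(½, 1)`, for an INDIVIDUAL Epstein zeta function `ζ(s, Q)` of a positive definite binary form with `k = √|d|/(2a) > 7.0556` [cite: Stark1967EpsteinZeros, §1] [cite: BatemanGrosswald1964, Theorem 3 (10)] (for `k > K`, among the zeros with `|t| ≤ 2k` exactly one real pair `β, 1 − β` lies off `σ = ½` [cite: Stark1967EpsteinZeros, Theorem 1]); hence (ii) every argument for such conclusions whose premises hold for each of these `ζ(s, Q)` — a (generalised) Dirichlet series with non-negative coefficients, a simple pole at `s = 1` and the degree-two functional equation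 `α(s) = α(1 − s)` [cite: Stark1967EpsteinZeros, §2 (13)] [cite: MontgomeryVaughan2007, §10.1 Exercise 25 (e)], the single-form expansion `a^s ζ(s, Q) = ζ(2s) + k^{1−2s}ζ(2s−1)Γ(s−½)√π/Γ(s) + h(s)` with exponentially small `h` [cite: Stark1967EpsteinZeros, §2 (9)] [cite: BatemanGrosswald1964, Theorem 1 (3)–(4)]; and (iii) CLASS-ISOLATED treatments of `w ζ_K = ∑_i ζ_{Q_i}` [cite: MontgomeryVaughan2007, §10.1 Exercise 26] that need each ideal-class zeta function free of real zeros, or of one sign, on `(½, 1)`: the principal class of every discriminant `d ≤ −200` has `k = √|d|/2 > 7.0556` (`principalForm_realZero`) [cite: Stark1967EpsteinZeros, §1 (2)]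
- because: `a^{½} Z(½) = γ + log k − log 4π + 2θ k^{−½} e^{−2πk}` (`|θ| < 1`, `k ≥ √3/2`), so `Z(½) > 0` if `k ≥ 7.0556` and `Z(½) < 0` if `√3/2 ≤ k ≤ 7.0554`, while `Z(s) → −∞` as `s → 1⁻` [cite: BatemanGrosswald1964, Theorem 3 (9)–(11)]; for large `k`, Rouché's theorem against `f(s) = ζ(2s)(k/π)^sΓ(s)` counts the zeros in Stark's box and sign changes of `α(½ + it)` place all but the real pair on the line [cite: Stark1967EpsteinZeros, §3 Lemma 5 and §4]; all three conjuncts are theorems of the tree (`EpsteinZetaRealZerosNarrow_holds`)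
- evasions_known: (a) the CLASS-AGGREGATE use of the same expansion — Selberg–Chowla / Kronecker's limit formula "summed over all ideal classes" gives `L′(1, χ) = (π²/6)∑_{(a,b,c) reduced} 1/a + (π/√d)∑ log(a/d) + O(h(−d)/√d)` and eq. (11) [cite: GranvilleStark2000, §3.2 eq. (11) and Theorem 3] (tree: `Literature.NumberTheory.DiophantineGeometry.granvilleStark_eq11`, proved), so that with `L′/L(1, χ) = 1/(1−β) + O(log d)` [cite: GranvilleStark2000, §3.1 Remark 1] the absence of a Siegel zero becomes the inequality `h(−d) ≥ {π/3 + o(1)}(√d/log d)∑ 1/a` on the minima of the reduced forms, which Granville–Stark's uniform `abc` hypothesis (their eq. (1)) supplies [cite: GranvilleStark2000, Theorems 1–2] [cite: IwaniecConversations2006, §3 (3.4)] (tree: `Literature.NumberTheory.DiophantineGeometry.granville_stark_noSiegelZeros_of_lemma1Data`); the class-summed central values `ζ_K(½) = ½∑_{(a,b,c)} a^{−½} log(√D/2a) + O(hD^{−1/4})` likewise turn `L(½, χ_D) ≥ 0` into the effective `h(−D) ≫ D^{1/4} log D` [cite: IwaniecConversations2006, §4 (4.24)–(4.25)]; (b)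 explicit class-aggregate verification — `L_{−d}(s) ≠ 0` for `s > 0` for every fundamental `−d` with `d < 593000` except possibly `d = 115147` [cite: Low1968, Theorem 5 (via MR 38#4425)], and for odd real characters up to conductor `3·10⁸` [cite: Watkins2004RealZeros, main theorem (via Cohen2007NumberTheoryII §10.5.7)] [cite: Cohen2007NumberTheoryII, §10.5.7] — in ranges where the principal Epstein zeta function of each `d ≤ −200` does vanish in `(½, 1)`; (c) the Deuring–Heilbronn phenomenon, which argues FROM an exceptional zero [cite: MontgomeryVaughan2007, §11.5 (notes to §11.3)]; (d) the Euler product when `h(d) = 1` [cite: MontgomeryVaughan2007, §10.1 Exercise 26]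
- scope_caveats: per FORM, not per discriminant or field: the real zero needs `k = √|d|/(2a) > 7.0556`, and for `√3/2 ≤ k ≤ 7.0554` the central value is negative [cite: BatemanGrosswald1964, Theorem 3 (11)] (second conjunct) — e.g. for `d = −203` the reduced forms `(1,1,51)`, `(3,±1,17)`, `(7,7,9)` have `k ≈ 7.12, 2.37, 2.37, 1.02` and only the principal class has `Z(½) > 0` (`d203_centralValue_signs`); the window `7.0554 < k < 7.0556` is left undecided by the printed constants [cite: BatemanGrosswald1964, Theorem 3 (10)–(11)]; nothing is asserted about the class sum `ζ(s)L(s, χ_{−d}) = ½∑_Q Z_Q(s)` (third conjunct), the object of `Literature.NumberTheory.LFunctions.NoSiegelZeros` and `Literature.NumberTheory.DiophantineGeometry.NoSiegelZerosOddQuadratic`; Stark's `K` is ineffective [cite: Stark1967EpsteinZeros, Theorem 1]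
- status: established (all conjuncts proved in the tree)

[cite: Stark1967EpsteinZeros, §1 and Theorem 1] [cite: BatemanGrosswald1964, Theorem 3 (10)–(11)] [cite: GranvilleStark2000, §3.2] -/
def EpsteinZetaRealZerosNarrow : Prop :=
  EpsteinZetaRealZeros ∧ BatemanGrosswald1964_eq11 ∧
    ∀ (d : ℕ) [NeZero d], 4 < d → ∀ χ : DirichletCharacter ℂ d, χ.IsPrimitive → χ.IsQuadratic → χ.Odd →
      ∀ s : ℝ, 1 < s →
        riemannZeta s * χ.LFunction s =
          1 / 2 * ∑ Q ∈ reducedForms (-(d : ℤ)), epsteinZeta (Q.1 : ℝ) (Q.2.1 : ℝ) (Q.2.2 : ℝ) s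

/-- The narrowed record contains the catalogued barrier. [cite: Stark1967EpsteinZeros, Theorem 1] -/
theorem EpsteinZetaRealZerosNarrow.epsteinZetaRealZeros (h : EpsteinZetaRealZerosNarrow) :
    EpsteinZetaRealZeros := h.1

/-- The narrowed record contains the complementary central-value inequality (11) of Bateman–Grosswald.
[cite: BatemanGrosswald1964, Theorem 3 (11)] -/
theorem EpsteinZetaRealZerosNarrow.eq11 (h : EpsteinZetaRealZerosNarrow) : BatemanGrosswald1964_eq11 :=
  h.2.1

/-- **Discharge of the narrowed record.** All three conjuncts are theorems of the tree: the barrier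
(`EpsteinZetaRealZeros_holds`: Bateman–Grosswald's real zero and Stark's Theorem 1), inequality (11)
(`BatemanGrosswald1964_eq11_holds`), and the class-sum identity
(`Literature.NumberTheory.DiophantineGeometry.riemannZeta_mul_LFunction_eq_half_sum`, Selberg–Chowla summed over the reduced
forms as in Granville–Stark §3.2).
[cite: Stark1967EpsteinZeros, Theorem 1] [cite: BatemanGrosswald1964, Theorem 3 (11)] [cite: GranvilleStark2000, §3.2] -/
theorem EpsteinZetaRealZerosNarrow_holds : EpsteinZetaRealZerosNarrow :=
  ⟨EpsteinZetaRealZeros_holds, BatemanGrosswald1964_eq11_holds,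
    fun _d _ hd _χ hprim hquad hodd _s hs =>
      Literature.NumberTheory.DiophantineGeometry.riemannZeta_mul_LFunction_eq_half_sum hd hprim hquad hodd hs⟩

/-! ## Where the barrier starts: every discriminant `d ≤ −200` has its principal class hit -/

/-- **The principal form of every discriminant `≤ −200` carries the Bateman–Grosswald zero.** For the
principal form `x² + bxy + cy²` (`k = √|d|/2`, `|d| = 4c − b²`), `|d| ≥ 200 > 4·7.0556²` gives
`k > 7.0556`, hence a real zero of (every analytic continuation of) `ζ_Q` in `(½, 1)` — so a
CLASS-ISOLATED sign argument for `w ζ_K = ∑_i ζ_{Q_i}` fails for every imaginary quadratic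
discriminant `≤ −200`, although the class sum itself has no real zero for `|d| < 593000` (Low) or
conductor `≤ 3·10⁸` (Watkins). [cite: Stark1967EpsteinZeros, §1 (2)] [cite: Low1968, Theorem 5 (via MR 38#4425)] -/
theorem principalForm_realZero {b c : ℝ} (h : IsPosDefForm 1 b c) (hd : 200 ≤ 4 * c - b ^ 2)
    (Z : ℂ → ℂ) (hZ : IsEpsteinContinuation 1 b c Z) :
    ∃ σ : ℝ, 1 / 2 < σ ∧ σ < 1 ∧ Z σ = 0 := by
  refine BatemanGrosswald1964_realZero_holds 1 b c h ?_ Z hZ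
  rw [starkK_one, lt_div_iff₀ (by norm_num : (0 : ℝ) < 2), Real.lt_sqrt (by norm_num)]
  nlinarith

/-! ## A boundary instance: `d = −203` -/

/-- The four reduced forms of discriminant `−203` (`h(−203) = 4`): `(1, 1, 51)`, `(3, 1, 17)`,
`(3, −1, 17)`, `(7, 7, 9)` are positive definite of discriminant `−203`. [folklore] -/
theorem d203_forms :
    IsPosDefForm 1 1 51 ∧ IsPosDefForm 3 1 17 ∧ IsPosDefForm 3 (-1) 17 ∧ IsPosDefForm 7 7 9 ∧
      (1 : ℝ) ^ 2 - 4 * 1 * 51 = -203 ∧ (1 : ℝ) ^ 2 - 4 * 3 * 17 = -203 ∧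
      (-1 : ℝ) ^ 2 - 4 * 3 * 17 = -203 ∧ (7 : ℝ) ^ 2 - 4 * 7 * 9 = -203 :=
  ⟨⟨by norm_num, by norm_num⟩, ⟨by norm_num, by norm_num⟩, ⟨by norm_num, by norm_num⟩,
    ⟨by norm_num, by norm_num⟩, by norm_num, by norm_num, by norm_num, by norm_num⟩

/-- `√203 > 14.1112 = 2 · 7.0556`. [folklore] -/
theorem sqrt203_gt : (14.1112 : ℝ) < Real.sqrt 203 := by
  rw [Real.lt_sqrt (by norm_num)]
  norm_num

/-- `√203 < 15`. [folklore] -/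
theorem sqrt203_lt : Real.sqrt 203 < 15 := by
  rw [Real.sqrt_lt' (by norm_num)]
  norm_num

/-- `3√3 ≤ √203` (so `√3/2 ≤ √203/6`) and `7√3 ≤ √203` (so `√3/2 ≤ √203/14`). [folklore] -/
theorem sqrt3_mul_le_sqrt203 : 3 * Real.sqrt 3 ≤ Real.sqrt 203 ∧ 7 * Real.sqrt 3 ≤ Real.sqrt 203 := by
  have h3 : Real.sqrt 3 ^ 2 = 3 := Real.sq_sqrt (by norm_num)
  constructor
  · exact Real.le_sqrt_of_sq_le (by nlinarith)
  · exact Real.le_sqrt_of_sq_le (by nlinarith)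

/-- **The Stark parameters of the reduced forms of discriminant `−203`**: `k = √203/(2a)` is
`> 7.0556` for the principal form `(1, 1, 51)` and lies in `[√3/2, 7.0554]` for `(3, ±1, 17)` and
`(7, 7, 9)`. [cite: Stark1967EpsteinZeros, §1 (2)] -/
theorem d203_starkK :
    (7.0556 : ℝ) < starkK 1 1 51 ∧
      (Real.sqrt 3 / 2 ≤ starkK 3 1 17 ∧ starkK 3 1 17 ≤ 7.0554) ∧
      (Real.sqrt 3 / 2 ≤ starkK 3 (-1) 17 ∧ starkK 3 (-1) 17 ≤ 7.0554) ∧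
      (Real.sqrt 3 / 2 ≤ starkK 7 7 9 ∧ starkK 7 7 9 ≤ 7.0554) := by
  have h1 : starkK 1 1 51 = Real.sqrt 203 / 2 := by rw [starkK]; norm_num
  have h3 : starkK 3 1 17 = Real.sqrt 203 / 6 := by rw [starkK]; norm_num
  have h3' : starkK 3 (-1) 17 = Real.sqrt 203 / 6 := by rw [starkK]; norm_num
  have h7 : starkK 7 7 9 = Real.sqrt 203 / 14 := by rw [starkK]; norm_num
  have hgt := sqrt203_gt
  have hlt := sqrt203_lt
  obtain ⟨ha, hb⟩ := sqrt3_mul_le_sqrt203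
  rw [h1, h3, h3', h7]
  refine ⟨by linarith, ⟨by linarith, by linarith⟩, ⟨by linarith, by linarith⟩, ⟨by linarith, by linarith⟩⟩

/-- **Boundary instance `d = −203` (the barrier is per form, not per discriminant).** For the four
ideal-class (Epstein) zeta functions of discriminant `−203` — any analytic continuations `Z₁`, `Z₃`,
`Z₃'`, `Z₇` of `ζ_Q` for `Q = (1,1,51), (3,1,17), (3,−1,17), (7,7,9)` — the central value is POSITIVE
and there is a real zero in `(½, 1)` for the principal class (Bateman–Grosswald (10), `k ≈ 7.12`),
while the central values of the three other classes are NEGATIVE (Bateman–Grosswald (11),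
`k ≈ 2.37, 2.37, 1.02`). The class sum `½(Z₁ + Z₃ + Z₃' + Z₇) = ζ(s)L(s, χ_{−203})` has no real zero
at all (`203 < 593000`, Low's Theorem 5), which is not a statement of this file.
[cite: BatemanGrosswald1964, Theorem 3 (10)–(11)] [cite: Low1968, Theorem 5 (via MR 38#4425)] -/
theorem d203_centralValue_signs {Z₁ Z₃ Z₃' Z₇ : ℂ → ℂ} (h₁ : IsEpsteinContinuation 1 1 51 Z₁)
    (h₃ : IsEpsteinContinuation 3 1 17 Z₃) (h₃' : IsEpsteinContinuation 3 (-1) 17 Z₃')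
    (h₇ : IsEpsteinContinuation 7 7 9 Z₇) :
    0 < (Z₁ (1 / 2)).re ∧ (∃ σ : ℝ, 1 / 2 < σ ∧ σ < 1 ∧ Z₁ σ = 0) ∧
      (Z₃ (1 / 2)).re < 0 ∧ (Z₃' (1 / 2)).re < 0 ∧ (Z₇ (1 / 2)).re < 0 := by
  obtain ⟨q1, q3, q3', q7, -⟩ := d203_forms
  obtain ⟨k1, ⟨k3l, k3u⟩, ⟨k3l', k3u'⟩, ⟨k7l, k7u⟩⟩ := d203_starkK
  exact ⟨BatemanGrosswald1964_eq10_holds 1 1 51 q1 k1.le Z₁ h₁,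
    BatemanGrosswald1964_realZero_holds 1 1 51 q1 k1 Z₁ h₁,
    BatemanGrosswald1964_eq11_holds 3 1 17 q3 k3l k3u Z₃ h₃,
    BatemanGrosswald1964_eq11_holds 3 (-1) 17 q3' k3l' k3u' Z₃' h₃',
    BatemanGrosswald1964_eq11_holds 7 7 9 q7 k7l k7u Z₇ h₇⟩

end Literature.Barriers.RiemannHypothesis

end
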